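import Mathlib
import Literature.Analysis.FluidPDE.EnstrophySplittingDissipation
import Summits.NavierStokesRegularity.NavierStokesRegularity.Theorems.LevelSetModerationLevelSetEnergyInequalityViscous

/-!
# Route LevelSetModeration — crux `HighSpeedPressureWork`, line `pressure_free_split`:
# stub S0 `stub_pressureFreeBound` (the exact level-set balance, upper half), helper file 1

Support lemmas for the registered stub `stub_pressureFreeBound` of item
stmt-NavierStokesRegularity-18149 (line `pressure_free_split`). The tree's
`LevelSetEnergyInequality` files prove Vasseur's level-set energy INEQUALITY by dropping the
nonnegative term `h(k₀)(|∇u|²_F - G)` in the regularised viscous identity (`viscous_step`). Here the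
identity is kept:

* `viscous_step_eq`: for `u ∈ C²(ℝ³)` with `u, Du, D²u ∈ L²`, `c > 0`, and a regularised truncation
  `h` vanishing near `0`,
  `∫ h(k₀(u)) ⟪Δu, u⟫ = -∫ (h(k₀) Σᵢ‖∂ᵢu‖² + h'(k₀)(1 - k₀) G)`,
  `k₀(u) = (|u|-c)₊/max(|u|,c)`, `G = Σᵢ⟪u, ∂ᵢu⟫²/max(|u|,c)²`
  (whole-space integration by parts against the `C¹` test field `h(k₀(u)) u`, exactly as in
  `viscous_step`);
* `viscous_slice_eq`: the limit `h → id` by dominated convergence,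
  `∫ k₀(u) ⟪Δu, u⟫ = -∫ (k₀(u) Σᵢ‖∂ᵢu‖² + 1_{|u|>c} (1 - k₀(u)) G)`.

## References
* A. F. Vasseur, *A new proof of partial regularity of solutions to Navier–Stokes equations*,
  NoDEA 14 (2007), Lemma 11 and its proof, (12). [Vasseur2007]
-/

noncomputable section

-- single-conjunct summit: `Summit.<Summit>.<Problem>` repeats the name by the D-0017 layout
set_option linter.dupNamespace false

namespace Summit.NavierStokesRegularity.NavierStokesRegularity.Theorems.LevelSetEnergyInequality

open Real Set Filter Topology MeasureTheory InnerProductSpace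
open scoped RealInnerProductSpace ENNReal Laplacian
open Literature.Analysis.FluidPDE

/-- **The regularised viscous identity.** For `u ∈ C²(ℝ³)` with `u, Du, D²u ∈ L²`, `c > 0`, and a
regularised truncation `h` (differentiable, `h`, `h'` continuous and vanishing on `(-∞, δ]` with
`δ > 0`, `0 ≤ h(y) ≤ y` for `y ≥ 0`, `|h'| ≤ M`):
`∫ h(k₀(u)) ⟪Δu, u⟫ = -∫ (h(k₀) Σᵢ ‖∂ᵢu‖² + h'(k₀)(1 - k₀) G)`, `G = Σᵢ⟪u, ∂ᵢu⟫² / max(|u|,c)²`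
(whole-space integration by parts with the test field `h(k₀(u)) u`, whose derivative is
`hasFDerivAt_regularisedField`; this is `viscous_step` before the nonnegative term
`h(k₀)(Σᵢ‖∂ᵢu‖² - G)` is dropped). -/
theorem viscous_step_eq {c : ℝ} (hc : 0 < c)
    {u : EuclideanSpace ℝ (Fin 3) → EuclideanSpace ℝ (Fin 3)} (hu : ContDiff ℝ 2 u)
    (h0 : ∫⁻ x, ‖u x‖ₑ ^ 2 < ⊤) (h1 : ∫⁻ x, ‖iteratedFDeriv ℝ 1 u x‖ₑ ^ 2 < ⊤)
    (h2 : ∫⁻ x, ‖iteratedFDeriv ℝ 2 u x‖ₑ ^ 2 < ⊤)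
    {h h' : ℝ → ℝ} {M δ : ℝ} (hder : ∀ y, HasDerivAt h (h' y) y) (hch : Continuous h)
    (hch' : Continuous h') (hδ : 0 < δ) (hδ0 : ∀ y, y ≤ δ → h y = 0 ∧ h' y = 0)
    (hbd : ∀ y, 0 ≤ y → 0 ≤ h y ∧ h y ≤ y) (hM : ∀ y, |h' y| ≤ M) :
    ∫ x, h (max (‖u x‖ - c) 0 / max ‖u x‖ c) * ⟪(Δ u) x, u x⟫ =
      -∫ x, (h (max (‖u x‖ - c) 0 / max ‖u x‖ c) *
          (∑ i, ‖fderiv ℝ u x (EuclideanSpace.basisFun (Fin 3) ℝ i)‖ ^ 2) +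
        h' (max (‖u x‖ - c) 0 / max ‖u x‖ c) * (1 - max (‖u x‖ - c) 0 / max ‖u x‖ c) *
          ((∑ i, ⟪u x, fderiv ℝ u x (EuclideanSpace.basisFun (Fin 3) ℝ i)⟫ ^ 2) /
            max ‖u x‖ c ^ 2)) := by
  set e := EuclideanSpace.basisFun (Fin 3) ℝ with he
  obtain ⟨k, hk⟩ : ∃ k : EuclideanSpace ℝ (Fin 3) → ℝ, k = fun v => max (‖v‖ - c) 0 / max ‖v‖ c :=
    ⟨_, rfl⟩
  obtain ⟨G, hG⟩ : ∃ G : EuclideanSpace ℝ (Fin 3) → ℝ,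
      G = fun x => (∑ i, ⟪u x, fderiv ℝ u x (e i)⟫ ^ 2) / max ‖u x‖ c ^ 2 := ⟨_, rfl⟩
  have hkx : ∀ v, k v = max (‖v‖ - c) 0 / max ‖v‖ c := fun v => by rw [hk]
  have hGx : ∀ x, G x = (∑ i, ⟪u x, fderiv ℝ u x (e i)⟫ ^ 2) / max ‖u x‖ c ^ 2 := fun x => by
    rw [hG]
  simp only [← hkx, ← hGx]
  have hM0 : 0 ≤ M := (abs_nonneg _).trans (hM 0)
  -- regularity of `u`
  have hud : Differentiable ℝ u := (hu.of_le one_le_two).differentiable one_ne_zero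
  have cu : Continuous u := hu.continuous
  have cDu : Continuous (fderiv ℝ u) := hu.continuous_fderiv (by norm_num)
  have cdi : ∀ i, Continuous fun x => fderiv ℝ u x (e i) := fun i => cDu.clm_apply continuous_const
  have hdfi : ∀ i, Differentiable ℝ (fun y => fderiv ℝ u y (e i)) := fun i =>
    ((hu.fderiv_right (m := 1) le_rfl).clm_apply contDiff_const).differentiable one_ne_zero
  have cddi : ∀ i, Continuous fun x => fderiv ℝ (fun y => fderiv ℝ u y (e i)) x (e i) := fun i =>
    (((hu.fderiv_right (m := 1) le_rfl).clm_apply contDiff_const).continuous_fderiv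
      one_ne_zero).clm_apply continuous_const
  have cΔ : Continuous (Δ u) := continuous_laplacian hu
  have cku : Continuous fun x => k (u x) := by rw [hk]; exact (continuous_weight hc).comp cu
  have cmax : Continuous fun x => max ‖u x‖ c := by fun_prop
  have hmaxpos : ∀ x, 0 < max ‖u x‖ c := fun x => lt_of_lt_of_le hc (le_max_right _ _)
  have hk01 : ∀ x, 0 ≤ k (u x) ∧ k (u x) ≤ 1 := fun x => by
    rw [hkx]; exact ⟨weight_nonneg hc _, weight_le_one hc _⟩
  have hkn01 : ∀ x, 0 ≤ h (k (u x)) ∧ h (k (u x)) ≤ 1 := fun x =>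
    ⟨(hbd _ (hk01 x).1).1, (hbd _ (hk01 x).1).2.trans (hk01 x).2⟩
  have cG : Continuous G := by
    rw [hG]
    exact Continuous.div (by fun_prop) (cmax.pow 2) fun x => (pow_pos (hmaxpos x) 2).ne'
  have hG0 : ∀ x, 0 ≤ G x := fun x => by
    rw [hGx]; exact div_nonneg (Finset.sum_nonneg fun i _ => sq_nonneg _) (sq_nonneg _)
  -- `L²` facts
  have l2di : ∀ i, ∫⁻ x, ‖fderiv ℝ u x (e i)‖ₑ ^ 2 < ⊤ := fun i =>
    lintegral_enorm_sq_lt_top_of_norm_le (fun x => norm_fderiv_apply_basisFun_le u x i) h1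
  have l2ddi : ∀ i, ∫⁻ x, ‖fderiv ℝ (fun y => fderiv ℝ u y (e i)) x (e i)‖ₑ ^ 2 < ⊤ := fun i =>
    lintegral_enorm_sq_lt_top_of_norm_le (fun x => norm_fderiv_fderiv_apply_basisFun_le hu x i) h2
  -- the test field `w = h(k₀(u)) u`, its derivative, the coefficient `A`
  obtain ⟨A, hA⟩ : ∃ A : EuclideanSpace ℝ (Fin 3) → ℝ,
      A = fun x => c * h' (k (u x)) / max ‖u x‖ c ^ 3 := ⟨_, rfl⟩
  have hAx : ∀ x, A x = c * h' (k (u x)) / max ‖u x‖ c ^ 3 := fun x => by rw [hA]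
  obtain ⟨w, hw⟩ : ∃ w : EuclideanSpace ℝ (Fin 3) → EuclideanSpace ℝ (Fin 3),
      w = fun x => h (k (u x)) • u x := ⟨_, rfl⟩
  obtain ⟨w', hw'⟩ : ∃ w' : EuclideanSpace ℝ (Fin 3) →
      EuclideanSpace ℝ (Fin 3) →L[ℝ] EuclideanSpace ℝ (Fin 3),
      w' = fun x => h (k (u x)) • fderiv ℝ u x +
        A x • ((innerSL ℝ (u x)).comp (fderiv ℝ u x)).smulRight (u x) := ⟨_, rfl⟩
  have hwx : ∀ x, w x = h (k (u x)) • u x := fun x => by rw [hw]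
  have hw'app : ∀ x v, w' x v = h (k (u x)) • fderiv ℝ u x v + (A x * ⟪u x, fderiv ℝ u x v⟫) • u x := by
    intro x v
    rw [hw']
    simp only [add_apply, smul_apply, ContinuousLinearMap.smulRight_apply,
      ContinuousLinearMap.comp_apply, innerSL_apply_apply, smul_smul]
  have hderivw : ∀ x, HasFDerivAt w (w' x) x := fun x => by
    simp only [hw, hw', hAx, hkx]
    exact hasFDerivAt_regularisedField hc hud hder hδ hδ0 x
  have cA : Continuous A := by
    rw [hA]
    exact Continuous.div (continuous_const.mul (hch'.comp cku)) (cmax.pow 3)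
      fun x => (pow_pos (hmaxpos x) 3).ne'
  have chk : Continuous fun x => h (k (u x)) := hch.comp cku
  have cw : Continuous w := by rw [hw]; exact chk.smul cu
  have cw'i : ∀ i, Continuous fun x => w' x (e i) := fun i => by
    simp_rw [hw'app]
    exact (chk.smul (cdi i)).add ((cA.mul (cu.inner (cdi i))).smul cu)
  have hAb : ∀ x, |A x| * ‖u x‖ ^ 2 ≤ M := fun x => by
    have hm := hmaxpos x
    rw [hAx, abs_div, abs_mul, abs_of_pos hc, abs_of_pos (pow_pos hm 3), div_mul_eq_mul_div,
      div_le_iff₀ (pow_pos hm 3)]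
    calc c * |h' (k (u x))| * ‖u x‖ ^ 2 ≤ max ‖u x‖ c * M * max ‖u x‖ c ^ 2 := by
          gcongr
          · exact le_max_right _ _
          · exact hM _
          · exact le_max_left _ _
      _ = M * max ‖u x‖ c ^ 3 := by ring
  have hwn : ∀ x, ‖w x‖ ≤ ‖u x‖ := fun x => by
    rw [hwx, norm_smul, Real.norm_of_nonneg (hkn01 x).1]
    exact mul_le_of_le_one_left (norm_nonneg _) (hkn01 x).2
  -- integrability of the three pairings
  have I1 : ∀ i, Integrable (fun x => ⟪fderiv ℝ (fun y => fderiv ℝ u y (e i)) x (e i), w x⟫)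
      volume := fun i =>
    integrable_of_norm_le_mul_of_lintegral_sq ((cddi i).inner cw).aestronglyMeasurable
      (cddi i) cu (l2ddi i) h0 fun x =>
      (norm_inner_le_norm _ _).trans (mul_le_mul_of_nonneg_left (hwn x) (norm_nonneg _))
  have I2 : ∀ i, Integrable (fun x => ⟪fderiv ℝ u x (e i), w' x (e i)⟫) volume := fun i => by
    have cb : Continuous fun x => (1 + M) • fderiv ℝ u x (e i) := (cdi i).const_smul (1 + M)
    have l2b : ∫⁻ x, ‖(1 + M) • fderiv ℝ u x (e i)‖ₑ ^ 2 < ⊤ :=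
      lintegral_enorm_sq_const_smul_lt_top (1 + M) (l2di i)
    refine integrable_of_norm_le_mul_of_lintegral_sq (b := fun x => (1 + M) • fderiv ℝ u x (e i))
      ((cdi i).inner (cw'i i)).aestronglyMeasurable (cdi i) cb (l2di i) l2b fun x => ?_
    refine (norm_inner_le_norm _ _).trans (mul_le_mul_of_nonneg_left ?_ (norm_nonneg _))
    rw [hw'app, norm_smul, Real.norm_of_nonneg (by linarith : (0 : ℝ) ≤ 1 + M), add_mul, one_mul]
    refine (norm_add_le _ _).trans (add_le_add ?_ ?_)
    · rw [norm_smul, Real.norm_of_nonneg (hkn01 x).1]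
      exact mul_le_of_le_one_left (norm_nonneg _) (hkn01 x).2
    · rw [norm_smul, Real.norm_eq_abs, abs_mul]
      calc |A x| * |⟪u x, fderiv ℝ u x (e i)⟫| * ‖u x‖
          ≤ |A x| * (‖u x‖ * ‖fderiv ℝ u x (e i)‖) * ‖u x‖ := by
            gcongr; exact abs_real_inner_le_norm _ _
        _ = (|A x| * ‖u x‖ ^ 2) * ‖fderiv ℝ u x (e i)‖ := by ring
        _ ≤ M * ‖fderiv ℝ u x (e i)‖ := mul_le_mul_of_nonneg_right (hAb x) (norm_nonneg _)
  have I3 : ∀ i, Integrable (fun x => ⟪fderiv ℝ u x (e i), w x⟫) volume := fun i =>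
    integrable_of_norm_le_mul_of_lintegral_sq ((cdi i).inner cw).aestronglyMeasurable
      (cdi i) cu (l2di i) h0 fun x =>
      (norm_inner_le_norm _ _).trans (mul_le_mul_of_nonneg_left (hwn x) (norm_nonneg _))
  -- integration by parts, coordinatewise, and summation: `∫ Σᵢ⟪∂ᵢu, ∂ᵢw⟫ = -∫ h(k₀)⟪Δu, u⟫`
  have hIBP : ∀ i, ∫ x, ⟪fderiv ℝ u x (e i), w' x (e i)⟫ =
      -∫ x, ⟪fderiv ℝ (fun y => fderiv ℝ u y (e i)) x (e i), w x⟫ := fun i =>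
    integral_bilinear_hasFDerivAt_right_eq_neg_left_of_integrable (μ := volume)
      (B := (innerSL ℝ : EuclideanSpace ℝ (Fin 3) →L[ℝ] EuclideanSpace ℝ (Fin 3) →L[ℝ] ℝ))
      (f := fun y => fderiv ℝ u y (e i)) (g := w) (v := e i) (by exact I1 i) (by exact I2 i)
      (by exact I3 i) (fun x _ => (hdfi i x).hasFDerivAt) (fun x _ => hderivw x)
  have hsumIBP : ∫ x, ∑ i, ⟪fderiv ℝ u x (e i), w' x (e i)⟫ =
      -∫ x, h (k (u x)) * ⟪(Δ u) x, u x⟫ := by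
    rw [integral_finsetSum _ fun i _ => I2 i]
    simp_rw [hIBP]
    rw [Finset.sum_neg_distrib, ← integral_finsetSum _ fun i _ => I1 i]
    congr 1
    refine integral_congr_ae (Eventually.of_forall fun x => ?_)
    show ∑ i, ⟪fderiv ℝ (fun y => fderiv ℝ u y (e i)) x (e i), w x⟫ = h (k (u x)) * ⟪(Δ u) x, u x⟫
    rw [laplacian_eq_sum_fderiv_fderiv e hu x, sum_inner, Finset.mul_sum]
    refine Finset.sum_congr rfl fun i _ => ?_
    rw [hwx, real_inner_smul_right]
  -- the pointwise identity `Σᵢ ⟪∂ᵢu, ∂ᵢw⟫ = h(k₀) Σᵢ‖∂ᵢu‖² + h'(k₀)(1-k₀) G`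
  have hpt : ∀ x, ∑ i, ⟪fderiv ℝ u x (e i), w' x (e i)⟫ =
      h (k (u x)) * (∑ i, ‖fderiv ℝ u x (e i)‖ ^ 2) + h' (k (u x)) * (1 - k (u x)) * G x := by
    intro x
    have h1 : ∀ i, ⟪fderiv ℝ u x (e i), w' x (e i)⟫ =
        h (k (u x)) * ‖fderiv ℝ u x (e i)‖ ^ 2 + A x * ⟪u x, fderiv ℝ u x (e i)⟫ ^ 2 := by
      intro i
      rw [hw'app, inner_add_right, real_inner_smul_right, real_inner_smul_right,
        real_inner_self_eq_norm_sq, real_inner_comm (fderiv ℝ u x (e i)) (u x)]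
      ring
    simp_rw [h1]
    rw [Finset.sum_add_distrib, ← Finset.mul_sum, ← Finset.mul_sum]
    congr 1
    rw [hAx, hGx, hkx, ← div_max_eq_one_sub_weight hc (u x)]
    have hm := (hmaxpos x).ne'
    field_simp
  have iS : Integrable (fun x => ∑ i, ⟪fderiv ℝ u x (e i), w' x (e i)⟫) volume :=
    integrable_finsetSum _ fun i _ => I2 i
  have hint : ∫ x, ∑ i, ⟪fderiv ℝ u x (e i), w' x (e i)⟫ =
      ∫ x, (h (k (u x)) * (∑ i, ‖fderiv ℝ u x (e i)‖ ^ 2) +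
        h' (k (u x)) * (1 - k (u x)) * G x) :=
    integral_congr_ae (Eventually.of_forall hpt)
  rw [hsumIBP] at hint
  linarith

/-- **The viscous identity of the level-set balance** (Vasseur 2007, Lemma 11, global form on `ℝ³`,
with the term the inequality drops kept): for `u ∈ C²` with `u, Du, D²u ∈ L²` and `c > 0`,
`∫ k₀(u) ⟪Δu, u⟫ = -∫ (k₀(u) Σᵢ‖∂ᵢu‖² + 1_{|u|>c} (1 - k₀(u)) G)`,
`G = Σᵢ⟪u, ∂ᵢu⟫² / max(|u|,c)²` (`viscous_step_eq` for `h = hₙ` of `exists_regularisation`, then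
dominated convergence with dominant `(1 + M) Σᵢ‖∂ᵢu‖²`). -/
theorem viscous_slice_eq {c : ℝ} (hc : 0 < c)
    {u : EuclideanSpace ℝ (Fin 3) → EuclideanSpace ℝ (Fin 3)} (hu : ContDiff ℝ 2 u)
    (h0 : ∫⁻ x, ‖u x‖ₑ ^ 2 < ⊤) (h1 : ∫⁻ x, ‖iteratedFDeriv ℝ 1 u x‖ₑ ^ 2 < ⊤)
    (h2 : ∫⁻ x, ‖iteratedFDeriv ℝ 2 u x‖ₑ ^ 2 < ⊤) :
    ∫ x, max (‖u x‖ - c) 0 / max ‖u x‖ c * ⟪(Δ u) x, u x⟫ =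
      -∫ x, (max (‖u x‖ - c) 0 / max ‖u x‖ c *
          (∑ i, ‖fderiv ℝ u x (EuclideanSpace.basisFun (Fin 3) ℝ i)‖ ^ 2) +
        Set.indicator {x | c < ‖u x‖} (fun x => (1 - max (‖u x‖ - c) 0 / max ‖u x‖ c) *
          ((∑ i, ⟪u x, fderiv ℝ u x (EuclideanSpace.basisFun (Fin 3) ℝ i)⟫ ^ 2) /
            max ‖u x‖ c ^ 2)) x) := by
  set e := EuclideanSpace.basisFun (Fin 3) ℝ with he
  obtain ⟨k, hk⟩ : ∃ k : EuclideanSpace ℝ (Fin 3) → ℝ, k = fun v => max (‖v‖ - c) 0 / max ‖v‖ c :=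
    ⟨_, rfl⟩
  obtain ⟨G, hG⟩ : ∃ G : EuclideanSpace ℝ (Fin 3) → ℝ,
      G = fun x => (∑ i, ⟪u x, fderiv ℝ u x (e i)⟫ ^ 2) / max ‖u x‖ c ^ 2 := ⟨_, rfl⟩
  obtain ⟨F, hF⟩ : ∃ F : EuclideanSpace ℝ (Fin 3) → ℝ,
      F = fun x => ∑ i, ‖fderiv ℝ u x (e i)‖ ^ 2 := ⟨_, rfl⟩
  have hkx : ∀ v, k v = max (‖v‖ - c) 0 / max ‖v‖ c := fun v => by rw [hk]
  have hGx : ∀ x, G x = (∑ i, ⟪u x, fderiv ℝ u x (e i)⟫ ^ 2) / max ‖u x‖ c ^ 2 := fun x => by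
    rw [hG]
  have hFx : ∀ x, F x = ∑ i, ‖fderiv ℝ u x (e i)‖ ^ 2 := fun x => by rw [hF]
  -- restate the goal with `k`, `G`, `F`
  suffices hmain : ∫ x, k (u x) * ⟪(Δ u) x, u x⟫ =
      -∫ x, (k (u x) * F x + Set.indicator {x | c < ‖u x‖} (fun x => (1 - k (u x)) * G x) x) by
    simpa only [hk, hG, hF] using hmain
  obtain ⟨h, h', M, hder, hcont, hcont', hvan, hbd, hM, hlim, hlim'⟩ := exists_regularisation
  have hM0 : 0 ≤ M := (abs_nonneg _).trans (hM 0 0)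
  have cu : Continuous u := hu.continuous
  have cDu : Continuous (fderiv ℝ u) := hu.continuous_fderiv (by norm_num)
  have cdi : ∀ i, Continuous fun x => fderiv ℝ u x (e i) := fun i => cDu.clm_apply continuous_const
  have cΔ : Continuous (Δ u) := continuous_laplacian hu
  have cku : Continuous fun x => k (u x) := by rw [hk]; exact (continuous_weight hc).comp cu
  have hk01 : ∀ x, 0 ≤ k (u x) ∧ k (u x) ≤ 1 := fun x => by
    rw [hkx]; exact ⟨weight_nonneg hc _, weight_le_one hc _⟩
  obtain ⟨cG, hG0, iG⟩ : Continuous G ∧ (∀ x, 0 ≤ G x) ∧ Integrable G volume := by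
    rw [hG]; exact integrable_levelGradSq hc (hu.of_le one_le_two) h1
  have cF : Continuous F := by rw [hF]; fun_prop
  have hF0 : ∀ x, 0 ≤ F x := fun x => by rw [hFx]; exact Finset.sum_nonneg fun i _ => sq_nonneg _
  have hGF : ∀ x, G x ≤ F x := fun x => by rw [hGx, hFx]; exact levelGradSq_le_sum_sq hc u x
  have l2di : ∀ i, ∫⁻ x, ‖fderiv ℝ u x (e i)‖ₑ ^ 2 < ⊤ := fun i =>
    lintegral_enorm_sq_lt_top_of_norm_le (fun x => norm_fderiv_apply_basisFun_le u x i) h1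
  have iF : Integrable F volume := by
    rw [hF]; exact integrable_finsetSum _ fun i _ => integrable_sq_norm_of_lintegral_lt_top (cdi i) (l2di i)
  have l2Δ : ∫⁻ x, ‖(Δ u) x‖ₑ ^ 2 < ⊤ := by
    have h3 : ∫⁻ x, ‖(3 : ℝ) • iteratedFDeriv ℝ 2 u x‖ₑ ^ 2 < ⊤ :=
      lintegral_enorm_sq_const_smul_lt_top 3 h2
    refine lintegral_enorm_sq_lt_top_of_norm_le (fun x => ?_) h3
    rw [norm_smul, Real.norm_of_nonneg (by norm_num : (0 : ℝ) ≤ 3)]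
    exact norm_laplacian_le_three_mul_norm_iteratedFDeriv_two hu x
  have iΔu : Integrable (fun x => ⟪(Δ u) x, u x⟫) volume :=
    integrable_of_norm_le_mul_of_lintegral_sq (cΔ.inner cu).aestronglyMeasurable cΔ cu l2Δ h0
      fun x => norm_inner_le_norm _ _
  -- the regularised identities
  have hstep : ∀ n : ℕ, ∫ x, h n (k (u x)) * ⟪(Δ u) x, u x⟫ =
      -∫ x, (h n (k (u x)) * F x + h' n (k (u x)) * (1 - k (u x)) * G x) := by
    intro n
    obtain ⟨δ, hδ, hδ0⟩ := hvan n
    have := viscous_step_eq hc hu h0 h1 h2 (hder n) (hcont n) (hcont' n) hδ hδ0 (hbd n) (hM n)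
    simpa only [hk, hG, hF] using this
  -- measurability of the two sequences of integrands
  have mL : ∀ n, Continuous fun x => h n (k (u x)) * ⟪(Δ u) x, u x⟫ := fun n =>
    ((hcont n).comp cku).mul (cΔ.inner cu)
  have mR : ∀ n, Continuous fun x => h n (k (u x)) * F x + h' n (k (u x)) * (1 - k (u x)) * G x :=
    fun n => (((hcont n).comp cku).mul cF).add ((((hcont' n).comp cku).mul
      (continuous_const.sub cku)).mul cG)
  -- ### the limit `n → ∞` by dominated convergence
  have hL : Tendsto (fun n => ∫ x, h n (k (u x)) * ⟪(Δ u) x, u x⟫) atTop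
      (𝓝 (∫ x, k (u x) * ⟪(Δ u) x, u x⟫)) := by
    refine tendsto_integral_of_dominated_convergence _ (fun n => (mL n).aestronglyMeasurable)
      iΔu.norm (fun n => ?_) ?_
    · filter_upwards with x
      rw [norm_mul]
      refine mul_le_of_le_one_left (norm_nonneg _) ?_
      have := hbd n (k (u x)) (hk01 x).1
      rw [Real.norm_of_nonneg this.1]
      exact this.2.trans (hk01 x).2
    · filter_upwards with x
      refine Tendsto.mul_const _ ?_
      rcases (hk01 x).1.lt_or_eq with hpos | hzero
      · exact hlim _ hpos
      · rw [← hzero]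
        have h00 : ∀ n, h n 0 = 0 := fun n => le_antisymm (hbd n 0 le_rfl).2 (hbd n 0 le_rfl).1
        simp only [h00]
        exact tendsto_const_nhds
  have hR : Tendsto (fun n => ∫ x, (h n (k (u x)) * F x + h' n (k (u x)) * (1 - k (u x)) * G x))
      atTop (𝓝 (∫ x, (k (u x) * F x +
        Set.indicator {x | c < ‖u x‖} (fun x => (1 - k (u x)) * G x) x))) := by
    refine tendsto_integral_of_dominated_convergence _ (fun n => (mR n).aestronglyMeasurable)
      (iF.const_mul (1 + M)) (fun n => ?_) ?_
    · filter_upwards with x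
      have hkn01 : 0 ≤ h n (k (u x)) ∧ h n (k (u x)) ≤ 1 :=
        ⟨(hbd n _ (hk01 x).1).1, (hbd n _ (hk01 x).1).2.trans (hk01 x).2⟩
      rw [Real.norm_eq_abs]
      calc |h n (k (u x)) * F x + h' n (k (u x)) * (1 - k (u x)) * G x|
          ≤ |h n (k (u x)) * F x| + |h' n (k (u x)) * (1 - k (u x)) * G x| := abs_add_le _ _
        _ = |h n (k (u x))| * F x + |h' n (k (u x))| * |1 - k (u x)| * G x := by
            rw [abs_mul, abs_mul, abs_mul, abs_of_nonneg (hF0 x), abs_of_nonneg (hG0 x)]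
        _ ≤ 1 * F x + M * 1 * F x := by
            have a1 : |h n (k (u x))| * F x ≤ 1 * F x :=
              mul_le_mul_of_nonneg_right (by rw [abs_of_nonneg hkn01.1]; exact hkn01.2) (hF0 x)
            have hk1abs : |1 - k (u x)| ≤ 1 := by
              rw [abs_of_nonneg (by linarith [(hk01 x).2])]; linarith [(hk01 x).1]
            have a2 : |h' n (k (u x))| * |1 - k (u x)| ≤ M * 1 :=
              mul_le_mul (hM n _) hk1abs (abs_nonneg _) hM0
            have a3 : |h' n (k (u x))| * |1 - k (u x)| * G x ≤ M * 1 * F x :=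
              mul_le_mul a2 (hGF x) (hG0 x) (by linarith)
            linarith
        _ = (1 + M) * F x := by ring
    · filter_upwards with x
      by_cases hx : c < ‖u x‖
      · rw [Set.indicator_of_mem (show x ∈ {x | c < ‖u x‖} from hx)]
        have hpos : 0 < k (u x) := by rw [hkx]; exact (weight_pos_iff hc _).2 hx
        have hl : Tendsto (fun n => h n (k (u x)) * F x + h' n (k (u x)) * (1 - k (u x)) * G x)
            atTop (𝓝 (k (u x) * F x + 1 * (1 - k (u x)) * G x)) :=
          ((hlim _ hpos).mul_const _).add (((hlim' _ hpos).mul_const _).mul_const _)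
        rwa [one_mul] at hl
      · rw [Set.indicator_of_notMem (show x ∉ {x | c < ‖u x‖} from hx)]
        have hk0 : k (u x) = 0 := by rw [hkx]; exact weight_eq_zero_of_norm_le _ (not_lt.1 hx)
        have hzero : ∀ n, h n (k (u x)) * F x + h' n (k (u x)) * (1 - k (u x)) * G x =
            k (u x) * F x + 0 := by
          intro n
          obtain ⟨δ, hδ, hδ0⟩ := hvan n
          rw [hk0, (hδ0 0 hδ.le).1, (hδ0 0 hδ.le).2]
          ring
        simp only [hzero]
        exact tendsto_const_nhds
  have hL' : Tendsto (fun n => ∫ x, h n (k (u x)) * ⟪(Δ u) x, u x⟫) atTop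
      (𝓝 (-(∫ x, (k (u x) * F x +
        Set.indicator {x | c < ‖u x‖} (fun x => (1 - k (u x)) * G x) x)))) := by
    simp only [hstep]
    exact hR.neg
  exact tendsto_nhds_unique hL hL'

end Summit.NavierStokesRegularity.NavierStokesRegularity.Theorems.LevelSetEnergyInequality


namespace Summit.NavierStokesRegularity.NavierStokesRegularity.Theorems

open MeasureTheory
open scoped ENNReal
open Summit.NavierStokesRegularity.NavierStokesRegularity.Theorems.LevelSetEnergyInequality

/-- **The viscous identity of the level-set balance, closed form** (registered helper of item
stmt-NavierStokesRegularity-18149, line `pressure_free_split`; `viscous_slice_eq` with explicit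
binders): for `u ∈ C²(ℝ³; ℝ³)` with `u, Du, D²u ∈ L²` and `c > 0`,
`∫ k₀(u) ⟪Δu, u⟫ = -∫ (k₀(u) Σᵢ‖∂ᵢu‖² + 1_{|u|>c} (1 - k₀(u)) Σᵢ⟪u, ∂ᵢu⟫²/max(|u|,c)²)`. -/
theorem levelSetModeration_viscousSliceIdentity :
    ∀ (c : ℝ) (u : EuclideanSpace ℝ (Fin 3) → EuclideanSpace ℝ (Fin 3)), 0 < c → ContDiff ℝ 2 u →
      ∫⁻ x, ‖u x‖ₑ ^ 2 < ⊤ → ∫⁻ x, ‖iteratedFDeriv ℝ 1 u x‖ₑ ^ 2 < ⊤ →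
      ∫⁻ x, ‖iteratedFDeriv ℝ 2 u x‖ₑ ^ 2 < ⊤ →
      ∫ x, max (‖u x‖ - c) 0 / max ‖u x‖ c * inner ℝ (Laplacian.laplacian u x) (u x) =
        -∫ x, (max (‖u x‖ - c) 0 / max ‖u x‖ c *
            (∑ i, ‖fderiv ℝ u x (EuclideanSpace.basisFun (Fin 3) ℝ i)‖ ^ 2) +
          Set.indicator {x | c < ‖u x‖} (fun x => (1 - max (‖u x‖ - c) 0 / max ‖u x‖ c) *
            ((∑ i, inner ℝ (u x) (fderiv ℝ u x (EuclideanSpace.basisFun (Fin 3) ℝ i)) ^ 2) /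
              max ‖u x‖ c ^ 2)) x) :=
  fun _ _ hc hu h0 h1 h2 => viscous_slice_eq hc hu h0 h1 h2

end Summit.NavierStokesRegularity.NavierStokesRegularity.Theorems

end
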